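import Mathlib
import Literature.Computability.AlgebraicComplexity.BirkhoffShadowLowerBound
import Literature.Computability.AlgebraicComplexity.PermanentUniversality
import HarnessLib

/-!
# Parametric shortest paths have `n^{Ω(log n)}` breakpoints (Carstensen; Mulmuley–Shah; Gajjar–Radhakrishnan)

The *parametric shortest path problem*: a directed acyclic graph with a source `s` and a sink `t` whose edge
weights are linear functions `a_e + b_e·λ` of a real parameter `λ`; the cost of an `s`–`t` path is then linear
in `λ`, and the cost of the shortest `s`–`t` path, `Cost(λ) = min_P Cost(P)(λ)`, is the piecewise linear concave
lower envelope of finitely many lines.  Its number of *breakpoints* (the points at which the envelope changes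
slope — the "parametric complexity" of Mulmuley–Shah; the number of linear pieces is one more) can be
super-polynomial in the size of the graph: Carstensen (1983) constructed `n`-vertex graphs with `n^{Ω(log n)}`
pieces, Mulmuley–Shah (2001, Thm 3.1 / Lemma 4.1) simplified her construction, and Gajjar–Radhakrishnan (2019,
Thm 1 / Lemma 7 "Main lemma", predicate `Φ(B, D, m)`) re-proved it in corrected detail (and for planar graphs);
Gusfield (1980) proved the matching upper bound `n^{log n + O(1)}`.

The recursive construction (`G = G_L ∘ G_M ∘ LINK ∘ G_R`, each level multiplying the number of pieces by `n` and the
size by `3`) is ALREADY in the tree, as the core of the Birkhoff-shadow lower bound: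
`Literature.Computability.AlgebraicComplexity.BirkhoffShadowLower.graph n m B D` (the non-planar `G(B, D, m)` as
a layered graph `List Layer` on row set `ℕ`), its dedicated walks `path n m b j`, the interval scheme `alpha`, and
`main_ineq` (property (iii) of `Φ`: on `I(j, m) = [α(j,m)+1, α(j,m)+n²−1]` the dedicated walk is the unique cheapest
walk from its input, by a margin `≥ 1`), `path_injective` (property (vi)), `adj_bound` / `length_graph`
(property (i)).  This file puts the THEOREM in a self-contained, consumable form — a DAG on topologically ordered
vertices `0, …, k` with source `0` and sink `k`, the indexing of the tree's ABP path sums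
`Literature.Computability.AlgebraicComplexity.pathSum` — and draws the printed conclusions:

* Part I, the model: `ParamDAG k` (adjacency `adj`, weights `wa + wb·λ`, `adj_lt`: edges increase the index);
  `ParamDAG.Path` (an `s`–`t` path: its number of edges `len` and its vertex sequence), `Path.strictMono`,
  `Path.len_le`, a `Fintype`; `Path.cost` / `icpt` / `slope` / `cost_eq` (`cost = icpt + slope·λ`); `Path.IsMin`
  (a shortest path at `λ`); `IsBreakpoint G λ` (two shortest paths at `λ` of different slopes, i.e. the envelope
  changes slope at `λ`).
* Part II (proved, [folklore]): `exists_isBreakpoint_of_isMin_of_not_isMin` — a lost lead forces a breakpoint (if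
  `P` is shortest at `μ₁` but not at `μ₂ > μ₁` there is a breakpoint in `[μ₁, μ₂)`: least crossing abscissa with
  the finitely many paths of smaller slope); `exists_strictMono_isBreakpoint_of_leads` — `N + 1` distinct paths
  each leading strictly on its own interval of a common positive length give `N` breakpoints, listed increasingly
  (the step "`n^m` dedicated intervals ⇒ `n^m` pieces" of all three sources); `finite_setOf_isBreakpoint` — the
  breakpoints form a finite set (each is a crossing abscissa of two path lines).
* Part III (proved, [folklore]): `withWeights` / `Path.transfer` (same arcs, new weights), `Path.sum_sub_eq`
  (telescoping along a path), `exists_natSlope` — RATIONAL SLOPES CAN BE MADE NATURAL NUMBERS without changing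
  the breakpoint structure (rescale `λ` by a common denominator, then add `c·(j − i)` to the slope of every arc
  `i → j`, which adds the same `c·k·λ` to every source–sink cost): what consumers building lacunary polynomials
  `Σ_paths (∏ c_e)·t^{Σ b_e}` need.
* Part IV (proved, [folklore] bookkeeping): `ofLayers L W` — a layered graph (`List Layer` of
  `BirkhoffShadowLower`) whose arcs stay in rows `< W`, as a `ParamDAG` on the grid vertices `i·W + x` plus a
  sink joined from the last column by arcs of weight `0`; `ofWalk` (indexed walk ↦ path), `cost_ofWalk`,
  `len_eq_of_ofLayers`, `ofWalk_rowOf` (every path is `ofWalk` of its row sequence), `slopeRat_ofLayers`.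
* Part V, the lower bound: `slopeRat_graph` (the slopes of the tree's `G(B, D, m)` are rational);
  `exists_paramDAG_leads` — **GR19 Lemma 7 at `B = 1`, `D = 0`, with the sink of the proof of Thm 1**: for
  `n ≥ 2` and all `m`, a parametric DAG on `k + 1 ≤ 3^m(1 + mn) + 1` vertices, rational slopes, `n^m` pairwise
  distinct paths `P_j` and `u_j = α(j,m) + 1` such that on `[u_j, u_j + n² − 2]` every other path costs at least
  `Cost(P_j) + 1`; `exists_strictMono_isBreakpoint` — hence `n^m − 1` breakpoints, listed increasingly (MS01
  Thm 3.1 / GR19 Thm 1); `exists_superpolynomial_isBreakpoint_natSlope` / `exists_superpolynomial_isBreakpoint`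
  — the form consumers want: for all `C, c` a parametric DAG on `k + 1` vertices (with natural-number edge
  slopes) with MORE than `C·(k+1)^c` breakpoints.
* Part VI (proved, [folklore]): `PathTo.prodLabels` (the weight of a path under edge labels `ℓ`), `PathTo.snoc` /
  `init` / `snocEquiv` (a path to `c ≠ 0` = a path to its penultimate vertex + its last arc), `labelsNat` (labels
  as weights of the transitive DAG on `ℕ`, zero off the arcs), and **`pathSum_labelsNat` /
  `pathSum_labelsNat_eq_sum_paths`**: the tree's ABP path sum `Literature.Computability.AlgebraicComplexity.pathSum`
  of these weights is the sum over the explicit paths of the products of their labels — the bridge from "lines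
  indexed by paths" to one branching program / Hessenberg determinant.

## Design notes

* Vertices are `Fin (k + 1)` in a topological order with `s = 0`, `t = k` (a source can always be listed first and
  a sink last); `adj` is `Prop`-valued (use `Classical` to branch on it); weights are real (the sources have
  rational, resp. `O(log³ n)`-bit integer weights — not recorded); weights off the edges are irrelevant.
* Layering is not part of the model.  A consumer needing equal path lengths or non-negative INTEGER slopes notes
  that the graphs of Part IV are layered (every path has `len = |L| + 1`, `len_eq_of_ofLayers`), or simply rescales
  `λ` and shifts each edge slope `b_{ij}` by `c·(j − i)`, which shifts the slope of every `s`–`t` path by `c·k`.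
* What is NOT here: planarity and the bit-length bounds of GR19 (property (ii)); Gusfield's upper bound; the PRAM
  lower bounds Mulmuley–Shah derive.

## References

* P. J. Carstensen, *Complexity of some parametric integer and network programming problems*, Math. Programming
  26 (1983) 64–75; *The complexity of some problems in parametric linear and combinatorial programming*, PhD
  thesis, Univ. of Michigan, 1983. [Carstensen1983]
* K. Mulmuley, P. Shah, *A lower bound for the shortest path problem*, J. Comput. System Sci. 63 (2001) 253–267
  (CCC 2000), §1 (parametric complexity), Thm 3.1, Lemma 4.1. [MulmuleyShah2001]
* K. Gajjar, J. Radhakrishnan, *Parametric shortest paths in planar graphs*, FOCS 2019, 876–895, arXiv:1811.05115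
  (full version ECCC TR18-211): Thm 1, §3 Lemma 7 (= Lemma 26 of the full version), Claims 8–9.
  [GajjarRadhakrishnan2019]
-/

noncomputable section

namespace Literature.Combinatorics.Optimization

open Finset

/-! ## Part I. The model -/

/-- A **parametric DAG** on the vertices `0, 1, …, k`, listed in a topological order (every edge increases the
index), with source `s = 0` and sink `t = k`: the edge `i → j` is present iff `adj i j`, and then has the weight
`wa i j + wb i j · λ`, linear in the real parameter `λ` (values of `wa`, `wb` off the edges are irrelevant).
[cite: GajjarRadhakrishnan2019, §1 (the parametric shortest path problem)] -/
structure ParamDAG (k : ℕ) where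
  /-- adjacency: `adj i j` iff there is an edge `i → j` -/
  adj : Fin (k + 1) → Fin (k + 1) → Prop
  /-- constant coefficient `a_e` of the edge weight `a_e + b_e λ` -/
  wa : Fin (k + 1) → Fin (k + 1) → ℝ
  /-- slope `b_e` of the edge weight `a_e + b_e λ` -/
  wb : Fin (k + 1) → Fin (k + 1) → ℝ
  /-- the vertex order is topological -/
  adj_lt : ∀ i j, adj i j → i < j

namespace ParamDAG

variable {k : ℕ} (G : ParamDAG k)

/-- A path of a parametric DAG from the source to the vertex `b`: `len` edges, vertex sequence
`verts 0 = 0 = s, …, verts len = b`, consecutive vertices adjacent. [cite: GajjarRadhakrishnan2019, §1] -/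
structure PathTo (b : Fin (k + 1)) where
  /-- number of edges -/
  len : ℕ
  /-- the vertex sequence -/
  verts : Fin (len + 1) → Fin (k + 1)
  /-- it starts at the source `0` -/
  start : verts 0 = 0
  /-- it ends at `b` -/
  stop : verts (Fin.last len) = b
  /-- consecutive vertices are joined by an edge -/
  step : ∀ c : Fin len, G.adj (verts c.castSucc) (verts c.succ)

/-- An `s`–`t` path of a parametric DAG: a path from the source `0` to the sink `k`.
[cite: GajjarRadhakrishnan2019, §1] -/
abbrev Path := G.PathTo (Fin.last k)

variable {G}

namespace PathTo

variable {b : Fin (k + 1)}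

/-- Two paths with the same length and the same vertex sequence are equal. [folklore] -/
theorem ext' {P Q : G.PathTo b} (h : P.len = Q.len)
    (hv : ∀ i : Fin (P.len + 1), P.verts i = Q.verts (Fin.cast (by rw [h]) i)) : P = Q := by
  obtain ⟨lP, vP, sP, tP, eP⟩ := P
  obtain ⟨lQ, vQ, sQ, tQ, eQ⟩ := Q
  dsimp only at h hv
  subst h
  have : vP = vQ := funext fun i => by simpa using hv i
  subst this
  rfl

/-- The vertex sequence of a path is strictly increasing (the vertex order is topological). [folklore] -/
theorem strictMono (P : G.PathTo b) : StrictMono P.verts :=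
  Fin.strictMono_iff_lt_succ.2 fun c => G.adj_lt _ _ (P.step c)

/-- Hence a path has at most `k` edges. [folklore] -/
theorem len_le (P : G.PathTo b) : P.len ≤ k := by
  have h := Fintype.card_le_of_injective _ P.strictMono.injective
  simp only [Fintype.card_fin] at h
  omega

end PathTo

/-- `PathTo G b` is finite: a path is determined by its length `len ≤ k` and its vertex sequence. [folklore] -/
instance instFintypePathTo {b : Fin (k + 1)} : Fintype (G.PathTo b) := by
  classical
  refine Fintype.ofInjective
    (fun P : G.PathTo b => (⟨⟨P.len, Nat.lt_succ_of_le P.len_le⟩, P.verts⟩ :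
      Σ l : Fin (k + 1), (Fin (l.val + 1) → Fin (k + 1)))) ?_
  intro P Q h
  simp only [Sigma.mk.injEq, Fin.mk.injEq] at h
  obtain ⟨hl, hv⟩ := h
  refine PathTo.ext' hl fun i => ?_
  obtain ⟨lP, vP, sP, tP, eP⟩ := P
  obtain ⟨lQ, vQ, sQ, tQ, eQ⟩ := Q
  dsimp only at hl hv ⊢
  subst hl
  simp only [heq_eq_eq] at hv
  subst hv
  simp

namespace Path

/-- Two `s`–`t` paths with the same length and the same vertex sequence are equal. [folklore] -/
theorem ext' {P Q : G.Path} (h : P.len = Q.len)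
    (hv : ∀ i : Fin (P.len + 1), P.verts i = Q.verts (Fin.cast (by rw [h]) i)) : P = Q :=
  PathTo.ext' h hv

/-- The vertex sequence of an `s`–`t` path is strictly increasing. [folklore] -/
theorem strictMono (P : G.Path) : StrictMono P.verts := PathTo.strictMono P

/-- An `s`–`t` path has at most `k` edges. [folklore] -/
theorem len_le (P : G.Path) : P.len ≤ k := PathTo.len_le P

/-- The cost of a path at the parameter value `μ`: the sum of its edge weights `a_e + b_e·μ`.
[cite: GajjarRadhakrishnan2019, §1] -/
def cost (P : G.Path) (μ : ℝ) : ℝ :=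
  ∑ c : Fin P.len, (G.wa (P.verts c.castSucc) (P.verts c.succ) + G.wb (P.verts c.castSucc) (P.verts c.succ) * μ)

/-- The intercept `Σ_e a_e` of the cost line of a path. [cite: GajjarRadhakrishnan2019, §1] -/
def icpt (P : G.Path) : ℝ := ∑ c : Fin P.len, G.wa (P.verts c.castSucc) (P.verts c.succ)

/-- The slope `Σ_e b_e` of the cost line of a path. [cite: GajjarRadhakrishnan2019, §1] -/
def slope (P : G.Path) : ℝ := ∑ c : Fin P.len, G.wb (P.verts c.castSucc) (P.verts c.succ)

/-- The cost of a path is the line `icpt + slope·μ`. [cite: GajjarRadhakrishnan2019, §1] -/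
theorem cost_eq (P : G.Path) (μ : ℝ) : P.cost μ = P.icpt + P.slope * μ := by
  simp only [cost, icpt, slope, Finset.sum_add_distrib, Finset.sum_mul]

/-- `P` is a shortest `s`–`t` path at the parameter value `μ`. [cite: GajjarRadhakrishnan2019, §1] -/
def IsMin (P : G.Path) (μ : ℝ) : Prop := ∀ Q : G.Path, P.cost μ ≤ Q.cost μ

end Path

/-- `μ` is a **breakpoint** of the parametric shortest path cost of `G`: two shortest paths at `μ` have different
slopes — equivalently, the concave piecewise linear envelope `λ ↦ min_P Cost(P)(λ)` changes slope at `μ` (its left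
and right derivatives there are the largest and the smallest slope of a shortest path at `μ`).  The number of
breakpoints is the *parametric complexity*; the number of linear pieces is one more.
[cite: MulmuleyShah2001, §1 (parametric complexity: "the number of breakpoints, i.e. points at which the function
changes slope")] -/
def IsBreakpoint (G : ParamDAG k) (μ : ℝ) : Prop :=
  ∃ P Q : G.Path, P.IsMin μ ∧ Q.IsMin μ ∧ P.slope ≠ Q.slope

/-! ## Part II. Breakpoints

### From a lost lead to a breakpoint -/

/-- For a path `Q` of smaller slope than `P`, the abscissa where the two cost lines cross. [folklore] -/
def Path.crossing (P Q : G.Path) : ℝ := (Q.icpt - P.icpt) / (P.slope - Q.slope)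

/-- If `slope Q < slope P` then `Cost P ≤ Cost Q` exactly to the left of the crossing abscissa. [folklore] -/
theorem Path.cost_le_cost_iff_le_crossing {P Q : G.Path} (h : Q.slope < P.slope) (μ : ℝ) :
    P.cost μ ≤ Q.cost μ ↔ μ ≤ P.crossing Q := by
  rw [Path.cost_eq, Path.cost_eq, Path.crossing, le_div_iff₀ (sub_pos.2 h)]
  constructor <;> intro hμ <;> nlinarith

/-- If `slope Q < slope P` then `Cost Q < Cost P` exactly to the right of the crossing abscissa. [folklore] -/
theorem Path.cost_lt_cost_iff_crossing_lt {P Q : G.Path} (h : Q.slope < P.slope) (μ : ℝ) :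
    Q.cost μ < P.cost μ ↔ P.crossing Q < μ := by
  rw [← not_le, Path.cost_le_cost_iff_le_crossing h, not_le]

/-- **A lost lead forces a breakpoint.**  If `P` is a shortest path at `μ₁` but not at some `μ₂ > μ₁`, then the
envelope has a breakpoint in `[μ₁, μ₂)`: among the (finitely many, and at least one) paths of smaller slope, the
least crossing abscissa `β` with `P` is a point where `P` is still shortest and is tied by a path of smaller slope.
[folklore] -/
theorem exists_isBreakpoint_of_isMin_of_not_isMin {P : G.Path} {μ₁ μ₂ : ℝ} (h₁ : P.IsMin μ₁) (h12 : μ₁ < μ₂)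
    (h₂ : ¬ P.IsMin μ₂) : ∃ β, μ₁ ≤ β ∧ β < μ₂ ∧ G.IsBreakpoint β := by
  classical
  -- a path beating `P` at `μ₂`; any such path has smaller slope
  obtain ⟨Q₀, hQ₀⟩ : ∃ Q : G.Path, Q.cost μ₂ < P.cost μ₂ := by
    by_contra hcon
    push Not at hcon
    exact h₂ hcon
  have hslope : ∀ Q : G.Path, Q.cost μ₂ < P.cost μ₂ → Q.slope < P.slope := by
    intro Q hQ
    have h1 := h₁ Q
    rw [Path.cost_eq, Path.cost_eq] at h1 hQ
    by_contra hs
    push Not at hs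
    nlinarith
  -- the paths of smaller slope, and the least crossing abscissa
  set F : Finset G.Path := Finset.univ.filter (fun Q => Q.slope < P.slope) with hF
  have hQ₀F : Q₀ ∈ F := by simpa [hF] using hslope Q₀ hQ₀
  have hFne : F.Nonempty := ⟨Q₀, hQ₀F⟩
  obtain ⟨Q₁, hQ₁F, hQ₁min⟩ := Finset.exists_min_image F (fun Q => P.crossing Q) hFne
  have hQ₁s : Q₁.slope < P.slope := by simpa [hF] using hQ₁F
  set β := P.crossing Q₁ with hβ
  refine ⟨β, ?_, ?_, ?_⟩
  · -- `P` is shortest at `μ₁`, so `μ₁` is left of every crossing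
    exact (Path.cost_le_cost_iff_le_crossing hQ₁s μ₁).1 (h₁ Q₁)
  · -- `Q₀` beats `P` at `μ₂`, so its crossing (hence the least one) is left of `μ₂`
    have h0 : P.crossing Q₀ < μ₂ := (Path.cost_lt_cost_iff_crossing_lt (hslope Q₀ hQ₀) μ₂).1 hQ₀
    exact lt_of_le_of_lt (hQ₁min Q₀ hQ₀F) h0
  · -- at `β`, `P` is still shortest and `Q₁` ties it
    have hPβ : P.IsMin β := by
      intro Q
      by_cases hs : Q.slope < P.slope
      · have hQF : Q ∈ F := by simpa [hF] using hs
        exact (Path.cost_le_cost_iff_le_crossing hs β).2 (hQ₁min Q hQF)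
      · push Not at hs
        have h1 := h₁ Q
        have hμβ : μ₁ ≤ β := (Path.cost_le_cost_iff_le_crossing hQ₁s μ₁).1 (h₁ Q₁)
        rw [Path.cost_eq, Path.cost_eq] at h1 ⊢
        nlinarith
    have htie : Q₁.cost β = P.cost β := by
      have hle : P.cost β ≤ Q₁.cost β := (Path.cost_le_cost_iff_le_crossing hQ₁s β).2 le_rfl
      rw [Path.cost_eq, Path.cost_eq] at hle ⊢
      have hden : P.slope - Q₁.slope ≠ 0 := (sub_pos.2 hQ₁s).ne'
      have hβ' : β * (P.slope - Q₁.slope) = Q₁.icpt - P.icpt := by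
        rw [hβ, Path.crossing, div_mul_cancel₀ _ hden]
      linarith
    refine ⟨P, Q₁, hPβ, fun Q => ?_, hQ₁s.ne'⟩
    rw [htie]
    exact hPβ Q

/-! ### From dedicated intervals to breakpoints -/

/-- **Pieces give breakpoints.**  If `N + 1` pairwise distinct paths `P i` each lead STRICTLY — every other path
costs more — throughout their own closed interval `[u i, u i + L]` of a common length `L > 0`, then the envelope
has at least `N` breakpoints, which we list increasingly.  (Two of the intervals cannot meet, since a common
point would have two different strict leaders; sorted by left end, consecutive intervals are separated, the
leader of the earlier one has lost the lead by the start of the later one, and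
`exists_isBreakpoint_of_isMin_of_not_isMin` puts a breakpoint in between.)
[cite: GajjarRadhakrishnan2019, proof of Thm 1 ("the graph admits `n^m` disjoint intervals, with a different
unique shortest `s`-`t` path in each; so the cost of the shortest `s`-`t` path in this graph has `n^{⌊log n⌋}`
pieces")] -/
theorem exists_strictMono_isBreakpoint_of_leads {N : ℕ} (P : Fin (N + 1) → G.Path) (hP : Function.Injective P)
    (u : Fin (N + 1) → ℝ) {L : ℝ} (hL : 0 < L)
    (hlead : ∀ j μ, μ ∈ Set.Icc (u j) (u j + L) → ∀ Q : G.Path, Q ≠ P j → (P j).cost μ < Q.cost μ) :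
    ∃ β : Fin N → ℝ, StrictMono β ∧ ∀ i, G.IsBreakpoint (β i) := by
  classical
  -- `P j` is shortest on its interval, and no other `P j'` is
  have hPmin : ∀ j μ, μ ∈ Set.Icc (u j) (u j + L) → (P j).IsMin μ := by
    intro j μ hμ Q
    by_cases hQ : Q = P j
    · rw [hQ]
    · exact (hlead j μ hμ Q hQ).le
  have hnotmin : ∀ j j' μ, j ≠ j' → μ ∈ Set.Icc (u j') (u j' + L) → ¬ (P j).IsMin μ := by
    intro j j' μ hjj' hμ hcon
    have hne : P j ≠ P j' := fun heq => hjj' (hP heq)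
    exact absurd (hcon (P j')) (not_le.2 (hlead j' μ hμ (P j) hne))
  -- the intervals are pairwise disjoint, in the strong form `u j + L < u j'` whenever `u j ≤ u j'`, `j ≠ j'`
  have hsep : ∀ j j', j ≠ j' → u j ≤ u j' → u j + L < u j' := by
    intro j j' hjj' hle
    by_contra hcon
    push Not at hcon
    exact hnotmin j j' (u j') hjj' ⟨le_rfl, by linarith⟩ (hPmin j (u j') ⟨hle, hcon⟩)
  have hu : Function.Injective u := by
    intro j j' hjj'
    by_contra hne
    have := hsep j j' hne hjj'.le
    linarith
  -- sort the left endpoints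
  set S : Finset ℝ := Finset.univ.image u with hS
  have hScard : S.card = N + 1 := by
    rw [hS, Finset.card_image_of_injective _ hu, Finset.card_univ, Fintype.card_fin]
  obtain ⟨e, hemem⟩ : ∃ e : Fin (N + 1) ↪o ℝ, ∀ i, e i ∈ S :=
    ⟨S.orderEmbOfFin hScard, fun i => Finset.orderEmbOfFin_mem S hScard i⟩
  -- the index `j i` with `u (j i) = e i`
  have hj : ∀ i, ∃ j, u j = e i := by
    intro i
    have := hemem i
    rw [hS, Finset.mem_image] at this
    obtain ⟨j, _, hj⟩ := this
    exact ⟨j, hj⟩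
  choose j hj using hj
  -- consecutive left endpoints belong to different paths and are more than `L` apart
  have hjne : ∀ c : Fin N, j c.castSucc ≠ j c.succ := fun c heq => by
    have := congrArg u heq
    rw [hj, hj] at this
    exact (e.strictMono (Fin.castSucc_lt_succ (i := c))).ne this
  have hgap : ∀ c : Fin N, e c.castSucc + L < e c.succ := by
    intro c
    have hlt : e c.castSucc < e c.succ := e.strictMono (Fin.castSucc_lt_succ (i := c))
    have := hsep (j c.castSucc) (j c.succ) (hjne c) (by rw [hj, hj]; exact hlt.le)
    rwa [hj, hj] at this
  -- a breakpoint in each gap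
  have hbp : ∀ c : Fin N, ∃ β, e c.castSucc + L ≤ β ∧ β < e c.succ ∧ G.IsBreakpoint β := by
    intro c
    refine exists_isBreakpoint_of_isMin_of_not_isMin (P := P (j c.castSucc)) ?_ (hgap c) ?_
    · exact hPmin (j c.castSucc) _ ⟨by rw [hj]; linarith, by rw [hj]⟩
    · exact hnotmin (j c.castSucc) (j c.succ) _ (hjne c) ⟨by rw [hj], by rw [hj]; linarith⟩
  choose β hβl hβr hβbp using hbp
  refine ⟨β, ?_, hβbp⟩
  -- strictly increasing: `β c < e (c+1) ≤ e (c+1) + L ≤ β (c+1)`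
  cases N with
  | zero => exact fun a => a.elim0
  | succ N' =>
    refine Fin.strictMono_iff_lt_succ.2 fun c => ?_
    have h1 := hβr c.castSucc
    have h2 := hβl c.succ
    have h3 : ((c.castSucc).succ : Fin (N' + 1 + 1)) = (c.succ).castSucc := by
      ext; simp
    rw [h3] at h1
    linarith

/-- **The breakpoints form a finite set**: each is a crossing abscissa of two of the finitely many path cost
lines (so "all breakpoints, sorted" makes sense, and points between consecutive ones are breakpoint-free).
[folklore] -/
theorem finite_setOf_isBreakpoint (G : ParamDAG k) : {μ | G.IsBreakpoint μ}.Finite := by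
  classical
  refine (Set.finite_range (fun pq : G.Path × G.Path => pq.1.crossing pq.2)).subset ?_
  rintro μ ⟨P, Q, hP, hQ, hne⟩
  have heq : P.cost μ = Q.cost μ := le_antisymm (hP Q) (hQ P)
  rw [Path.cost_eq, Path.cost_eq] at heq
  rcases lt_or_gt_of_ne hne with h | h
  · refine ⟨(Q, P), ?_⟩
    show Q.crossing P = μ
    rw [Path.crossing, eq_comm, eq_div_iff (sub_pos.2 h).ne']
    linarith
  · refine ⟨(P, Q), ?_⟩
    show P.crossing Q = μ
    rw [Path.crossing, eq_comm, eq_div_iff (sub_pos.2 h).ne']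
    linarith

/-! ## Part III. Reweighting: natural-number slopes without loss of generality

The lacunary-polynomial consumers of the bound (`t = e^{s}`, edge label `c_e·t^{b_e}`) need NATURAL NUMBER edge
slopes.  Any parametric DAG with rational slopes is normalised without touching its shortest-path structure:
rescale the parameter by a common denominator `Δ` (`λ = Δ·s`), then add `c·(j − i)` to the slope of each arc
`i → j`, which adds the same `c·k·s` to the cost of every source–sink path (`exists_natSlope`). -/

section Reweight

variable {k : ℕ}

/-- The same DAG with new weights. [folklore] -/
def withWeights (G : ParamDAG k) (wa' wb' : Fin (k + 1) → Fin (k + 1) → ℝ) : ParamDAG k :=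
  ⟨G.adj, wa', wb', G.adj_lt⟩

variable {G : ParamDAG k} {wa' wb' : Fin (k + 1) → Fin (k + 1) → ℝ}

/-- A path of `G` as a path of the reweighted DAG (same arcs). [folklore] -/
def Path.transfer (P : G.Path) : (G.withWeights wa' wb').Path := ⟨P.len, P.verts, P.start, P.stop, P.step⟩

/-- A path of the reweighted DAG as a path of `G`. [folklore] -/
def Path.transferBack (P : (G.withWeights wa' wb').Path) : G.Path := ⟨P.len, P.verts, P.start, P.stop, P.step⟩

/-- `transfer ∘ transferBack = id`. [folklore] -/
@[simp] theorem Path.transfer_transferBack (P : (G.withWeights wa' wb').Path) :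
    (Path.transferBack P).transfer = P := by
  cases P; rfl

/-- `transferBack ∘ transfer = id`. [folklore] -/
@[simp] theorem Path.transferBack_transfer (P : G.Path) :
    (P.transfer : (G.withWeights wa' wb').Path).transferBack = P := by
  cases P; rfl

/-- The vertex indices of a path, as a sequence on `ℕ` (junk `0` past the end). [folklore] -/
def Path.vtx (P : G.Path) (i : ℕ) : ℕ := if h : i < P.len + 1 then (P.verts ⟨i, h⟩).val else 0

/-- **Telescoping**: along a source–sink path the index increments add up to `k`. [folklore] -/
theorem Path.sum_sub_eq (P : G.Path) :
    ∑ c : Fin P.len, (((P.verts c.succ).val : ℝ) - (P.verts c.castSucc).val) = k := by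
  have hsum : ∑ c : Fin P.len, (((P.verts c.succ).val : ℝ) - (P.verts c.castSucc).val) =
      ∑ i ∈ Finset.range P.len, (((P.vtx (i + 1) : ℕ) : ℝ) - (P.vtx i : ℕ)) := by
    rw [← Fin.sum_univ_eq_sum_range]
    refine Finset.sum_congr rfl fun c _ => ?_
    have h1 : P.vtx (c.val + 1) = (P.verts c.succ).val := by
      rw [Path.vtx, dif_pos (by omega)]; rfl
    have h2 : P.vtx c.val = (P.verts c.castSucc).val := by
      rw [Path.vtx, dif_pos (by omega)]; rfl
    rw [h1, h2]
  rw [hsum, Finset.sum_range_sub (fun i => ((P.vtx i : ℕ) : ℝ)) P.len]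
  have hlast : P.vtx P.len = k := by
    rw [Path.vtx, dif_pos (Nat.lt_succ_self _)]
    have : P.verts ⟨P.len, Nat.lt_succ_self _⟩ = Fin.last k := P.stop
    rw [this, Fin.val_last]
  have hfirst : P.vtx 0 = 0 := by
    rw [Path.vtx, dif_pos (Nat.succ_pos _)]
    have : P.verts ⟨0, Nat.succ_pos _⟩ = 0 := P.start
    rw [this, Fin.val_zero]
  rw [hlast, hfirst]
  simp

/-- **Rational slopes can be made natural** without changing the shortest-path structure: if every slope of `G`
is rational, there is a DAG `G'` on the same vertices and arcs with natural-number slopes whose breakpoints are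
those of `G` rescaled by a positive constant.  (`λ = Δ·s` for a common denominator `Δ`, then add `c·(j − i)` to the
slope of each arc `i → j`: every source–sink cost gains the same `c·k·s`.) [folklore] -/
theorem exists_natSlope (G : ParamDAG k) (hq : ∀ u v, ∃ q : ℚ, G.wb u v = q) :
    ∃ (wbn : Fin (k + 1) → Fin (k + 1) → ℕ) (Δ : ℝ), 0 < Δ ∧
      ∀ μ, G.IsBreakpoint μ ↔ (G.withWeights G.wa (fun u v => (wbn u v : ℝ))).IsBreakpoint (μ / Δ) := by
  classical
  choose q hq using hq
  -- a common denominator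
  set Δ : ℕ := ∏ p : Fin (k + 1) × Fin (k + 1), (q p.1 p.2).den with hΔ
  have hΔpos : 0 < Δ := Finset.prod_pos fun p _ => (q p.1 p.2).den_pos
  have hz : ∀ u v, ∃ z : ℤ, (z : ℚ) = (Δ : ℚ) * q u v := by
    intro u v
    have hdvd : (q u v).den ∣ Δ := Finset.dvd_prod_of_mem (fun p : Fin (k + 1) × Fin (k + 1) => (q p.1 p.2).den)
      (Finset.mem_univ (u, v))
    obtain ⟨t, ht⟩ := hdvd
    refine ⟨t * (q u v).num, ?_⟩
    have hmul : q u v * (q u v).den = (q u v).num := Rat.mul_den_eq_num (q u v)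
    rw [ht]
    push_cast
    rw [← hmul]
    ring
  choose z hz using hz
  -- a shift making all slopes non-negative
  set c : ℕ := ∑ p : Fin (k + 1) × Fin (k + 1), (z p.1 p.2).natAbs with hc
  have hcz : ∀ u v, -(c : ℤ) ≤ z u v := by
    intro u v
    have h1 : (z u v).natAbs ≤ c :=
      Finset.single_le_sum (f := fun p : Fin (k + 1) × Fin (k + 1) => (z p.1 p.2).natAbs) (fun _ _ => Nat.zero_le _)
        (Finset.mem_univ (u, v))
    have h2 : -((z u v).natAbs : ℤ) ≤ z u v := by
      rcases Int.natAbs_eq (z u v) with h | h <;> omega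
    omega
  set wbn : Fin (k + 1) → Fin (k + 1) → ℕ := fun u v => (z u v + c * ((v.val : ℤ) - u.val)).toNat with hwbn
  -- on arcs the natural slope is `Δ·wb + c·(v − u)`
  have hwbn_edge : ∀ u v : Fin (k + 1), u < v →
      ((wbn u v : ℕ) : ℝ) = (Δ : ℝ) * G.wb u v + (c : ℝ) * ((v.val : ℝ) - u.val) := by
    intro u v huv
    have huv' : (u.val : ℤ) + 1 ≤ v.val := by exact_mod_cast Fin.lt_def.1 huv
    have hnn : 0 ≤ z u v + c * ((v.val : ℤ) - u.val) := by nlinarith [hcz u v]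
    have h1 : ((wbn u v : ℕ) : ℤ) = z u v + c * ((v.val : ℤ) - u.val) := by
      rw [hwbn]; exact Int.toNat_of_nonneg hnn
    have h2 : ((wbn u v : ℕ) : ℝ) = ((z u v : ℤ) : ℝ) + (c : ℝ) * ((v.val : ℝ) - u.val) := by
      have := congrArg (fun x : ℤ => (x : ℝ)) h1
      push_cast at this
      exact this
    have h3 : ((z u v : ℤ) : ℝ) = (Δ : ℝ) * G.wb u v := by
      rw [hq u v]
      have := congrArg (fun x : ℚ => (x : ℝ)) (hz u v)
      push_cast at this
      exact this
    rw [h2, h3]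
  set G' : ParamDAG k := G.withWeights G.wa (fun u v => (wbn u v : ℝ)) with hG'
  -- costs along transferred paths
  have hcost : ∀ (P : G.Path) (s : ℝ), (P.transfer : G'.Path).cost s = P.cost (Δ * s) + (c : ℝ) * k * s := by
    intro P s
    rw [Path.cost_eq, Path.cost_eq]
    have hi : (P.transfer : G'.Path).icpt = P.icpt := rfl
    have hs : (P.transfer : G'.Path).slope = (Δ : ℝ) * P.slope + (c : ℝ) * k := by
      show ∑ d : Fin P.len, ((wbn (P.verts d.castSucc) (P.verts d.succ) : ℕ) : ℝ) = _
      rw [Finset.sum_congr rfl fun d _ => hwbn_edge _ _ (P.strictMono (Fin.castSucc_lt_succ (i := d))),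
        Finset.sum_add_distrib, ← Finset.mul_sum, ← Finset.mul_sum, P.sum_sub_eq]
      rfl
    rw [hi, hs]
    ring
  have hslope : ∀ P : G.Path, (P.transfer : G'.Path).slope = (Δ : ℝ) * P.slope + (c : ℝ) * k := by
    intro P
    have h1 := hcost P 1
    have h0 := hcost P 0
    rw [Path.cost_eq, Path.cost_eq] at h1 h0
    have hi : (P.transfer : G'.Path).icpt = P.icpt := rfl
    rw [hi] at h1
    linarith
  have hmin : ∀ (P : G.Path) (s : ℝ), (P.transfer : G'.Path).IsMin s ↔ P.IsMin (Δ * s) := by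
    intro P s
    constructor
    · intro h Q
      have := h Q.transfer
      rw [hcost, hcost] at this
      linarith
    · intro h Q'
      have := h Q'.transferBack
      rw [← Path.transfer_transferBack Q', hcost, hcost]
      linarith
  have hΔR : (0 : ℝ) < Δ := by exact_mod_cast hΔpos
  refine ⟨wbn, Δ, hΔR, fun μ => ?_⟩
  have hμ : (Δ : ℝ) * (μ / Δ) = μ := mul_div_cancel₀ μ hΔR.ne'
  constructor
  · rintro ⟨P, Q, hP, hQ, hne⟩
    refine ⟨P.transfer, Q.transfer, (hmin P _).2 (by rwa [hμ]), (hmin Q _).2 (by rwa [hμ]), ?_⟩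
    rw [hslope, hslope]
    intro h
    apply hne
    have := mul_left_cancel₀ hΔR.ne' (add_right_cancel h)
    exact this
  · rintro ⟨P', Q', hP, hQ, hne⟩
    refine ⟨P'.transferBack, Q'.transferBack, ?_, ?_, ?_⟩
    · have := (hmin P'.transferBack (μ / Δ)).1 (by rwa [Path.transfer_transferBack])
      rwa [hμ] at this
    · have := (hmin Q'.transferBack (μ / Δ)).1 (by rwa [Path.transfer_transferBack])
      rwa [hμ] at this
    · intro h
      apply hne
      rw [← Path.transfer_transferBack P', ← Path.transfer_transferBack Q', hslope, hslope, h]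

end Reweight

/-! ## Part IV. Layered graphs as parametric DAGs -/

section OfLayers

open Literature.Computability.AlgebraicComplexity.BirkhoffShadowLower

variable (L : List Layer) (W : ℕ)

/-- The parametric DAG of a layered graph `L` (a list of `|L|` layers of arcs between consecutive columns, on row
set `ℕ`, as in `BirkhoffShadowLower`) whose arcs stay in rows `< W`: vertex `i·W + x` is row `x` of column `i`
(`i ≤ |L|`, `x < W`), column `i` is joined to column `i + 1` by the arcs of layer `i` with their weights, and the
extra vertex `(|L|+1)·W` is the sink, joined from every vertex of the last column by an arc of weight `0`; the
source `0` is row `0` of column `0`. [cite: GajjarRadhakrishnan2019, proof of Thm 1 ("we connect all vertices in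
the last layer to a new vertex `t` using edges of weight `0`")] -/
def ofLayers : ParamDAG ((L.length + 1) * W) where
  adj u v :=
    (u.val < (L.length + 1) * W ∧ v.val = (L.length + 1) * W ∧ u.val / W = L.length) ∨
    (v.val < (L.length + 1) * W ∧ v.val / W = u.val / W + 1 ∧
      (layerAt L (u.val / W)).adj (u.val % W) (v.val % W))
  wa u v := if v.val = (L.length + 1) * W then 0 else ((layerAt L (u.val / W)).w (u.val % W) (v.val % W)).1
  wb u v := if v.val = (L.length + 1) * W then 0 else ((layerAt L (u.val / W)).w (u.val % W) (v.val % W)).2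
  adj_lt u v h := by
    rcases h with ⟨hu, hv, -⟩ | ⟨hv, hcol, -⟩
    · exact Fin.lt_def.2 (by omega)
    · have hW : 0 < W := Nat.pos_of_ne_zero (by rintro rfl; simp at hv)
      refine Fin.lt_def.2 ?_
      calc u.val < (u.val / W + 1) * W := (Nat.div_lt_iff_lt_mul hW).1 (Nat.lt_succ_self _)
        _ = (v.val / W) * W := by rw [hcol]
        _ ≤ v.val := Nat.div_mul_le_self _ _

variable {L W}

/-- The arcs of `ofLayers L W`, unfolded. [folklore] -/
theorem adj_ofLayers (u v : Fin ((L.length + 1) * W + 1)) : (ofLayers L W).adj u v ↔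
    (u.val < (L.length + 1) * W ∧ v.val = (L.length + 1) * W ∧ u.val / W = L.length) ∨
    (v.val < (L.length + 1) * W ∧ v.val / W = u.val / W + 1 ∧
      (layerAt L (u.val / W)).adj (u.val % W) (v.val % W)) := Iff.rfl

/-- The constant coefficients of `ofLayers L W`, unfolded. [folklore] -/
theorem wa_ofLayers (u v : Fin ((L.length + 1) * W + 1)) : (ofLayers L W).wa u v =
    if v.val = (L.length + 1) * W then 0 else ((layerAt L (u.val / W)).w (u.val % W) (v.val % W)).1 := rfl

/-- The slopes of `ofLayers L W`, unfolded. [folklore] -/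
theorem wb_ofLayers (u v : Fin ((L.length + 1) * W + 1)) : (ofLayers L W).wb u v =
    if v.val = (L.length + 1) * W then 0 else ((layerAt L (u.val / W)).w (u.val % W) (v.val % W)).2 := rfl

/-- Column of a grid vertex. [folklore] -/
theorem code_div (hW0 : 0 < W) (i : ℕ) {x : ℕ} (hx : x < W) : (i * W + x) / W = i := by
  rw [Nat.add_comm, Nat.add_mul_div_right _ _ hW0, Nat.div_eq_of_lt hx, Nat.zero_add]

/-- Row of a grid vertex. [folklore] -/
theorem code_mod (i : ℕ) {x : ℕ} (hx : x < W) : (i * W + x) % W = x := by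
  rw [Nat.add_comm, Nat.add_mul_mod_self_right, Nat.mod_eq_of_lt hx]

/-- Grid vertices precede the sink. [folklore] -/
theorem code_lt {T i x : ℕ} (hi : i ≤ T) (hx : x < W) : i * W + x < (T + 1) * W := by nlinarith

/-- Beyond the last layer there are no arcs. [folklore] -/
theorem layerAt_adj_of_le {i : ℕ} (hi : L.length ≤ i) (x y : ℕ) : ¬ (layerAt L i).adj x y := by
  rw [layerAt, List.getD_eq_default _ _ hi]
  exact id

/-- If all slopes of the layers are rational, so are the slopes of `ofLayers L W`. [folklore] -/
theorem slopeRat_ofLayers (hL : ∀ l ∈ L, ∀ x y, ∃ q : ℚ, (l.w x y).2 = q)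
    (u v : Fin ((L.length + 1) * W + 1)) : ∃ q : ℚ, (ofLayers L W).wb u v = q := by
  rw [wb_ofLayers]
  split_ifs with h
  · exact ⟨0, by simp⟩
  · by_cases hi : u.val / W < L.length
    · exact hL _ (layerAt_mem L hi) _ _
    · refine ⟨0, ?_⟩
      rw [layerAt, List.getD_eq_default _ _ (Nat.not_lt.1 hi)]
      simp

/-- Along an indexed walk from row `0`, all rows are `< W`. [folklore] -/
theorem row_lt_of_isWalkI (hW0 : 0 < W) (hW : ∀ l ∈ L, ∀ x y, l.adj x y → x < W ∧ y < W) {f : ℕ → ℕ}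
    (hf0 : f 0 = 0) (hf : IsWalkI L f) : ∀ i ≤ L.length, f i < W
  | 0, _ => by rw [hf0]; exact hW0
  | i + 1, hi => (hW _ (layerAt_mem L (by omega)) _ _ (hf i (by omega))).2

/-- The `i`-th vertex of the path of an indexed walk `f` (`f i` = the row in column `i`): the grid vertex
`i·W + f i` while `i ≤ |L|` (and the row is in range), the sink afterwards. [folklore] -/
def walkVert (L : List Layer) (W : ℕ) (f : ℕ → ℕ) (i : ℕ) : Fin ((L.length + 1) * W + 1) :=
  if h : i ≤ L.length ∧ f i < W then ⟨i * W + f i, Nat.lt_succ_of_lt (code_lt h.1 h.2)⟩ else Fin.last _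

/-- The grid vertices of `walkVert`. [folklore] -/
theorem val_walkVert_of_le {f : ℕ → ℕ} {i : ℕ} (hi : i ≤ L.length) (hfi : f i < W) :
    (walkVert L W f i).val = i * W + f i := by
  simp [walkVert, hi, hfi]

/-- After the last column, `walkVert` is the sink. [folklore] -/
theorem walkVert_of_lt {f : ℕ → ℕ} {i : ℕ} (hi : L.length < i) : walkVert L W f i = Fin.last _ := by
  simp [walkVert, Nat.not_le.2 hi]

/-- The path of an indexed walk `f` from row `0` through `L`: the grid vertices `i·W + f i` for `i ≤ |L|`, then
the sink. [folklore] -/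
def ofWalk (hW0 : 0 < W) (hW : ∀ l ∈ L, ∀ x y, l.adj x y → x < W ∧ y < W) (f : ℕ → ℕ) (hf0 : f 0 = 0)
    (hf : IsWalkI L f) : (ofLayers L W).Path where
  len := L.length + 1
  verts i := walkVert L W f i.val
  start := by
    apply Fin.ext
    show (walkVert L W f 0).val = 0
    rw [val_walkVert_of_le (Nat.zero_le _) (by rw [hf0]; exact hW0), hf0]
    simp
  stop := by
    show walkVert L W f (L.length + 1) = Fin.last _
    exact walkVert_of_lt (Nat.lt_succ_self _)
  step c := by
    have hrow := row_lt_of_isWalkI hW0 hW hf0 hf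
    have hc : c.val ≤ L.length := Nat.lt_succ_iff.1 c.isLt
    show (ofLayers L W).adj (walkVert L W f c.val) (walkVert L W f (c.val + 1))
    rw [adj_ofLayers]
    by_cases hcT : c.val < L.length
    · -- an arc of layer `c`
      have hc1 : c.val + 1 ≤ L.length := hcT
      right
      rw [val_walkVert_of_le hc1 (hrow _ hc1), val_walkVert_of_le hc (hrow _ hc), code_div hW0 _ (hrow _ hc1),
        code_div hW0 _ (hrow _ hc), code_mod _ (hrow _ hc), code_mod _ (hrow _ hc1)]
      exact ⟨code_lt hc1 (hrow _ hc1), rfl, hf c.val hcT⟩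
    · -- the arc into the sink
      have hcT' : c.val = L.length := by omega
      left
      rw [val_walkVert_of_le hc (hrow _ hc), code_div hW0 _ (hrow _ hc), walkVert_of_lt (by omega)]
      exact ⟨code_lt hc (hrow _ hc), rfl, hcT'⟩

/-- The vertices of `ofWalk`. [folklore] -/
theorem verts_ofWalk (hW0 : 0 < W) (hW : ∀ l ∈ L, ∀ x y, l.adj x y → x < W ∧ y < W) (f : ℕ → ℕ)
    (hf0 : f 0 = 0) (hf : IsWalkI L f) (i : Fin (L.length + 1 + 1)) :
    (ofWalk hW0 hW f hf0 hf).verts i = walkVert L W f i.val := rfl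

/-- `ofWalk` only depends on the rows in columns `≤ |L|`. [folklore] -/
theorem ofWalk_congr (hW0 : 0 < W) (hW : ∀ l ∈ L, ∀ x y, l.adj x y → x < W ∧ y < W) {f g : ℕ → ℕ}
    (hf0 : f 0 = 0) (hf : IsWalkI L f) (hg0 : g 0 = 0) (hg : IsWalkI L g) (h : ∀ i ≤ L.length, f i = g i) :
    ofWalk hW0 hW f hf0 hf = ofWalk hW0 hW g hg0 hg := by
  refine Path.ext' rfl fun i => ?_
  show walkVert L W f i.val = walkVert L W g i.val
  by_cases hi : i.val ≤ L.length
  · apply Fin.ext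
    rw [val_walkVert_of_le hi (row_lt_of_isWalkI hW0 hW hf0 hf _ hi),
      val_walkVert_of_le hi (row_lt_of_isWalkI hW0 hW hg0 hg _ hi), h _ hi]
  · rw [walkVert_of_lt (Nat.not_le.1 hi), walkVert_of_lt (Nat.not_le.1 hi)]

/-- The cost of `ofWalk f` is the cost of the walk `f` (the arc into the sink is free). [folklore] -/
theorem cost_ofWalk (hW0 : 0 < W) (hW : ∀ l ∈ L, ∀ x y, l.adj x y → x < W ∧ y < W) (f : ℕ → ℕ)
    (hf0 : f 0 = 0) (hf : IsWalkI L f) (μ : ℝ) :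
    (ofWalk hW0 hW f hf0 hf).cost μ = eval (costI L f) μ := by
  have hrow := row_lt_of_isWalkI hW0 hW hf0 hf
  have hterm : ∀ d : Fin (L.length + 1),
      (ofLayers L W).wa (walkVert L W f d.val) (walkVert L W f (d.val + 1)) +
        (ofLayers L W).wb (walkVert L W f d.val) (walkVert L W f (d.val + 1)) * μ =
      if d.val < L.length then
        ((layerAt L d.val).w (f d.val) (f (d.val + 1))).1 + ((layerAt L d.val).w (f d.val) (f (d.val + 1))).2 * μ
      else 0 := by
    intro d
    rw [wa_ofLayers, wb_ofLayers]
    have hd : d.val ≤ L.length := Nat.lt_succ_iff.1 d.isLt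
    by_cases hdT : d.val < L.length
    · have hd1 : d.val + 1 ≤ L.length := hdT
      have hne : (walkVert L W f (d.val + 1)).val ≠ (L.length + 1) * W := by
        rw [val_walkVert_of_le hd1 (hrow _ hd1)]; exact (code_lt hd1 (hrow _ hd1)).ne
      rw [if_pos hdT, if_neg hne, if_neg hne, val_walkVert_of_le hd1 (hrow _ hd1), val_walkVert_of_le hd (hrow _ hd),
        code_div hW0 _ (hrow _ hd), code_mod _ (hrow _ hd), code_mod _ (hrow _ hd1)]
    · have heq : (walkVert L W f (d.val + 1)).val = (L.length + 1) * W := by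
        rw [walkVert_of_lt (by omega)]; simp
      rw [if_neg hdT, if_pos heq, if_pos heq]
      ring
  unfold Path.cost
  show ∑ d : Fin (L.length + 1), ((ofLayers L W).wa (walkVert L W f d.castSucc.val) (walkVert L W f d.succ.val) +
      (ofLayers L W).wb (walkVert L W f d.castSucc.val) (walkVert L W f d.succ.val) * μ) = _
  simp only [Fin.val_castSucc, Fin.val_succ]
  rw [Finset.sum_congr rfl fun d _ => hterm d, Fin.sum_univ_castSucc]
  simp only [Fin.val_castSucc, Fin.is_lt, if_true, Fin.val_last, lt_self_iff_false, if_false, add_zero]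
  rw [costI, eval, Prod.fst_sum, Prod.snd_sum, Finset.mul_sum, ← Finset.sum_add_distrib,
    ← Fin.sum_univ_eq_sum_range]
  refine Finset.sum_congr rfl fun d _ => ?_
  ring

/-- The row sequence of a path of `ofLayers L W` (junk `0` beyond its length). [folklore] -/
def rowOf (P : (ofLayers L W).Path) (i : ℕ) : ℕ := if h : i < P.len + 1 then (P.verts ⟨i, h⟩).val % W else 0

/-- A path starts in row `0`. [folklore] -/
theorem rowOf_zero (P : (ofLayers L W).Path) : rowOf P 0 = 0 := by
  have h0 : P.verts 0 = 0 := P.start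
  simp [rowOf, h0]

/-- The rows of `ofWalk f` are the `f i`. [folklore] -/
theorem rowOf_ofWalk (hW0 : 0 < W) (hW : ∀ l ∈ L, ∀ x y, l.adj x y → x < W ∧ y < W) (f : ℕ → ℕ)
    (hf0 : f 0 = 0) (hf : IsWalkI L f) {i : ℕ} (hi : i ≤ L.length) : rowOf (ofWalk hW0 hW f hf0 hf) i = f i := by
  have hi' : i < (ofWalk hW0 hW f hf0 hf).len + 1 := by show i < L.length + 1 + 1; omega
  rw [rowOf, dif_pos hi']
  show (walkVert L W f i).val % W = f i
  rw [val_walkVert_of_le hi (row_lt_of_isWalkI hW0 hW hf0 hf _ hi), code_mod _ (row_lt_of_isWalkI hW0 hW hf0 hf _ hi)]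

variable (hW0 : 0 < W)
include hW0

/-- On a path of `ofLayers L W`, the `i`-th vertex (`i ≤ |L|`) is a grid vertex of column `i`. [folklore] -/
theorem col_verts (P : (ofLayers L W).Path) :
    ∀ (i : ℕ) (hi : i < P.len + 1), i ≤ L.length →
      (P.verts ⟨i, hi⟩).val < (L.length + 1) * W ∧ (P.verts ⟨i, hi⟩).val / W = i
  | 0, hi, _ => by
    have h0 : P.verts ⟨0, hi⟩ = 0 := P.start
    rw [h0]
    refine ⟨?_, by simp⟩
    show 0 < (L.length + 1) * W
    positivity
  | i + 1, hi, hle => by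
    obtain ⟨-, hcol⟩ := col_verts P i (by omega) (by omega)
    have hstep := P.step ⟨i, by omega⟩
    have e1 : P.verts (Fin.castSucc ⟨i, by omega⟩) = P.verts ⟨i, by omega⟩ := rfl
    have e2 : P.verts (Fin.succ ⟨i, by omega⟩) = P.verts ⟨i + 1, hi⟩ := rfl
    rw [e1, e2, adj_ofLayers] at hstep
    rcases hstep with ⟨-, -, hc⟩ | ⟨hv, hc, -⟩
    · omega
    · exact ⟨hv, by rw [hc, hcol]⟩

/-- Every path of `ofLayers L W` has exactly `|L| + 1` arcs. [folklore] -/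
theorem len_eq_of_ofLayers (P : (ofLayers L W).Path) : P.len = L.length + 1 := by
  -- at least `|L| + 1`: otherwise the last vertex would be a grid vertex, not the sink
  have hge : L.length + 1 ≤ P.len := by
    by_contra hlt
    push Not at hlt
    obtain ⟨hv, -⟩ := col_verts hW0 P P.len (Nat.lt_succ_self _) (by omega)
    have hstop : P.verts ⟨P.len, Nat.lt_succ_self _⟩ = Fin.last _ := P.stop
    rw [hstop] at hv
    simp at hv
  -- at most `|L| + 1`: after column `|L|` comes the sink, which has no out-arcs
  by_contra hne
  have hgt : L.length + 2 ≤ P.len := by omega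
  obtain ⟨-, hcolT⟩ := col_verts hW0 P L.length (by omega) le_rfl
  have hstepT := P.step ⟨L.length, by omega⟩
  have e1 : P.verts (Fin.castSucc ⟨L.length, by omega⟩) = P.verts ⟨L.length, by omega⟩ := rfl
  have e2 : P.verts (Fin.succ ⟨L.length, by omega⟩) = P.verts ⟨L.length + 1, by omega⟩ := rfl
  rw [e1, e2, adj_ofLayers] at hstepT
  have hsink : (P.verts ⟨L.length + 1, by omega⟩).val = (L.length + 1) * W := by
    rcases hstepT with ⟨-, hv, -⟩ | ⟨-, -, hadj⟩
    · exact hv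
    · exfalso
      rw [hcolT] at hadj
      exact layerAt_adj_of_le le_rfl _ _ hadj
  have hstep2 := P.step ⟨L.length + 1, by omega⟩
  have e3 : P.verts (Fin.castSucc ⟨L.length + 1, by omega⟩) = P.verts ⟨L.length + 1, by omega⟩ := rfl
  rw [e3, adj_ofLayers] at hstep2
  rcases hstep2 with ⟨hu, -, -⟩ | ⟨-, -, hadj⟩
  · omega
  · rw [hsink, Nat.mul_div_cancel _ hW0] at hadj
    exact layerAt_adj_of_le (Nat.le_succ _) _ _ hadj

/-- The row sequence of a path is an indexed walk. [folklore] -/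
theorem isWalkI_rowOf (P : (ofLayers L W).Path) : IsWalkI L (rowOf P) := by
  intro i hi
  have hlen := len_eq_of_ofLayers hW0 P
  obtain ⟨-, hcol⟩ := col_verts hW0 P i (by omega) hi.le
  have hstep := P.step ⟨i, by omega⟩
  have e1 : P.verts (Fin.castSucc ⟨i, by omega⟩) = P.verts ⟨i, by omega⟩ := rfl
  have e2 : P.verts (Fin.succ ⟨i, by omega⟩) = P.verts ⟨i + 1, by omega⟩ := rfl
  rw [e1, e2, adj_ofLayers] at hstep
  rcases hstep with ⟨-, -, hc⟩ | ⟨-, -, hadj⟩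
  · omega
  · rw [hcol] at hadj
    have h1 : rowOf P i = (P.verts ⟨i, by omega⟩).val % W := by
      rw [rowOf, dif_pos (show i < P.len + 1 by omega)]
    have h2 : rowOf P (i + 1) = (P.verts ⟨i + 1, by omega⟩).val % W := by
      rw [rowOf, dif_pos (show i + 1 < P.len + 1 by omega)]
    rwa [h1, h2]

/-- **Every path of `ofLayers L W` is `ofWalk` of its row sequence.** [folklore] -/
theorem ofWalk_rowOf (hW : ∀ l ∈ L, ∀ x y, l.adj x y → x < W ∧ y < W) (P : (ofLayers L W).Path) :
    ofWalk hW0 hW (rowOf P) (rowOf_zero P) (isWalkI_rowOf hW0 P) = P := by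
  have hlen := len_eq_of_ofLayers hW0 P
  refine Path.ext' hlen.symm fun i => ?_
  have hil : i.val < L.length + 1 + 1 := i.isLt
  have hcast : (Fin.cast (by rw [hlen]; rfl) i : Fin (P.len + 1)) = ⟨i.val, by omega⟩ := rfl
  rw [hcast]
  show walkVert L W (rowOf P) i.val = _
  by_cases hi : i.val ≤ L.length
  · apply Fin.ext
    have hrowlt := row_lt_of_isWalkI hW0 hW (rowOf_zero P) (isWalkI_rowOf hW0 P) _ hi
    rw [val_walkVert_of_le hi hrowlt]
    obtain ⟨-, hcol⟩ := col_verts hW0 P i.val (by omega) hi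
    have hrow : rowOf P i.val = (P.verts ⟨i.val, by omega⟩).val % W := by
      rw [rowOf, dif_pos (show i.val < P.len + 1 by omega)]
    have hdm := Nat.div_add_mod (P.verts ⟨i.val, by omega⟩).val W
    rw [hcol, Nat.mul_comm] at hdm
    rw [hrow]
    exact hdm
  · rw [walkVert_of_lt (Nat.not_le.1 hi)]
    have hi' : i.val = P.len := by omega
    have : (⟨i.val, by omega⟩ : Fin (P.len + 1)) = Fin.last P.len := Fin.ext (by simp [hi'])
    rw [this, P.stop]

end OfLayers

/-! ## Part V. The lower bound -/

section LowerBound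

open Literature.Computability.AlgebraicComplexity.BirkhoffShadowLower

/-- `K_R` is a natural number. [cite: GajjarRadhakrishnan2019, §4.3 (28)] -/
theorem KR_eq_natCast (n B : ℕ) : KR n B = ((20 * (n ^ 2) ^ 3 * B : ℕ) : ℝ) := by
  rw [KR]; push_cast; ring

/-- `K_L` is a natural number. [cite: GajjarRadhakrishnan2019, §4.3 (27)] -/
theorem KL_eq_natCast (n B m : ℕ) : KL n B m = ((400 * (n ^ 2) ^ (m + 5) * B ^ 2 : ℕ) : ℝ) := by
  rw [KL]; push_cast; ring

/-- Rescaling by natural `K`, `N` keeps slopes rational. [folklore] -/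
theorem slopeRat_smap {l : Layer} (hl : ∀ x y, ∃ q : ℚ, (l.w x y).2 = q) (K N : ℕ) (x y : ℕ) :
    ∃ q : ℚ, ((l.smap (K : ℝ) (N : ℝ)).w x y).2 = q := by
  obtain ⟨q, hq⟩ := hl x y
  refine ⟨K * q / N, ?_⟩
  show (K : ℝ) * (l.w x y).2 / N = _
  rw [hq]; push_cast; ring

/-- **The slopes of `G(B, D, m)` are rational** (they are built from naturals by `K·(·)/N` and `−K_R r/N`; the
parameter `D` only enters the constant terms). [cite: GajjarRadhakrishnan2019, §4.3 (31) and Lemma 7 (ii)] -/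
theorem slopeRat_graph (n : ℕ) : ∀ m B D, ∀ l ∈ graph n m B D, ∀ x y, ∃ q : ℚ, (l.w x y).2 = q
  | 0, _, _, l, hl, _, _ => by simp [graph] at hl
  | m + 1, B, D, l, hl, x, y => by
    simp only [graph, List.append_assoc, List.mem_append, List.mem_map, List.mem_singleton, mem_mirror] at hl
    have hN : ((n : ℝ) ^ 2) = ((n ^ 2 : ℕ) : ℝ) := by push_cast; ring
    rcases hl with ⟨l', hl', rfl⟩ | hl | rfl | ⟨l', hl', rfl⟩
    · rw [KL_eq_natCast, hN]
      exact slopeRat_smap (slopeRat_graph n m B _ l' hl') _ _ x y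
    · obtain ⟨a, ha, h3⟩ := hl
      have h4 : l = (a.smap (KL n B m) ((n : ℝ) ^ 2)).flip := by rw [h3, Layer.flip_flip]
      subst h4
      show ∃ q : ℚ, ((a.smap (KL n B m) ((n : ℝ) ^ 2)).w y x).2 = q
      rw [KL_eq_natCast, hN]
      exact slopeRat_smap (slopeRat_graph n m B _ a ha) _ _ y x
    · refine ⟨-((20 * (n ^ 2) ^ 3 * B : ℕ) * ((y - x : ℕ) : ℚ) / (n ^ 2 : ℕ)), ?_⟩
      show -(KR n B * ((y - x : ℕ) : ℝ) / (n : ℝ) ^ 2) = _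
      rw [KR_eq_natCast]; push_cast; ring
    · rw [KR_eq_natCast, hN]
      exact slopeRat_smap (slopeRat_graph n m (B + n) 1 l' hl') _ _ x y

/-- **Gajjar–Radhakrishnan 2019, Lemma 7 (Main lemma) at `B = 1`, `D = 0`, with the sink of the proof of Thm 1;
Mulmuley–Shah 2001, Lemma 4.1 / Thm 3.1; Carstensen 1983.**  For every `n ≥ 2` and `m` there is a parametric DAG
on `k + 1 ≤ 3^m (1 + mn) + 1` vertices together with `n^m` pairwise distinct source–sink paths `P_j` and the reals
`u_j = α(j, m) + 1` such that for every `λ` in `[u_j, u_j + n² − 2]` (the printed `I(j,m) = [α(j,m)+1, α(j,m)+N−1]`,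
`N = n²`) every other source–sink path costs at least `Cost(P_j)(λ) + 1` (properties (i), (iii), (vi) of
`Φ(1, 0, m)`); moreover all edge slopes are rational.  The graph is the tree's `BirkhoffShadowLower.graph n m 1 0`
read through `ofLayers`.
[cite: GajjarRadhakrishnan2019, Lemma 7 and proof of Thm 1] -/
theorem exists_paramDAG_leads (n m : ℕ) (hn : 2 ≤ n) :
    ∃ (k : ℕ) (G : ParamDAG k) (P : Fin (n ^ m) → G.Path) (u : Fin (n ^ m) → ℝ),
      k + 1 ≤ 3 ^ m * (1 + m * n) + 1 ∧ Function.Injective P ∧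
      (∀ (j : Fin (n ^ m)) (μ : ℝ), μ ∈ Set.Icc (u j) (u j + ((n : ℝ) ^ 2 - 2)) →
        ∀ Q : G.Path, Q ≠ P j → (P j).cost μ + 1 ≤ Q.cost μ) ∧
      ∀ v w, ∃ q : ℚ, G.wb v w = q := by
  classical
  have hn1 : 1 ≤ n := by omega
  set L : List Layer := graph n m 1 0 with hL
  set W : ℕ := 1 + m * n with hWdef
  have hW0 : 0 < W := by rw [hWdef]; omega
  have hW : ∀ l ∈ L, ∀ x y, l.adj x y → x < W ∧ y < W := fun l hl x y h => adj_bound n m 1 0 l hl x y h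
  have hlenL : L.length = len m := length_graph n m 1 0
  -- the dedicated walks, indexed form
  set f : ℕ → ℕ → ℕ := fun j i => (0 :: path n m 0 j).getD i 0 with hfdef
  have hf0 : ∀ j, f j 0 = 0 := fun j => by simp [hfdef]
  have hwalk : ∀ j, j < n ^ m → IsWalk L 0 (path n m 0 j) :=
    fun j hj => isWalk_path hn1 m 1 0 0 j Nat.one_pos hj
  have hf : ∀ j, j < n ^ m → IsWalkI L (f j) ∧ cost L 0 (path n m 0 j) = costI L (f j) :=
    fun j hj => isWalkI_of_isWalk (hwalk j hj)
  refine ⟨(L.length + 1) * W, ofLayers L W,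
    fun j => ofWalk hW0 hW (f j.val) (hf0 j.val) (hf j.val j.isLt).1,
    fun j => (alpha n m j.val : ℝ) + 1, ?_, ?_, ?_,
    slopeRat_ofLayers (fun l hl x y => slopeRat_graph n m 1 0 l hl x y)⟩
  · -- size: `(len m + 1)(1 + mn) + 1 ≤ 3^m (1 + mn) + 1`
    have h3 := two_mul_len_add_one m
    rw [hlenL]
    nlinarith [Nat.zero_le (len m), Nat.zero_le (m * n)]
  · -- distinct
    intro j j' hjj'
    apply Fin.ext
    refine path_injective hn1 m 0 j.val j'.val j.isLt j'.isLt ?_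
    have hv : ∀ i ≤ L.length, f j.val i = f j'.val i := by
      intro i hi
      have h := congrArg (fun P : (ofLayers L W).Path => rowOf P i) hjj'
      simp only at h
      rwa [rowOf_ofWalk hW0 hW _ _ _ hi, rowOf_ofWalk hW0 hW _ _ _ hi] at h
    have hl : (path n m 0 j.val).length = (path n m 0 j'.val).length := by rw [length_path, length_path]
    refine List.ext_getElem hl fun i h1 h2 => ?_
    have hi : i + 1 ≤ L.length := by rw [hlenL]; rw [length_path] at h1; omega
    have := hv (i + 1) hi
    simp only [hfdef, List.getD_cons_succ] at this
    rwa [List.getD_eq_getElem _ _ h1, List.getD_eq_getElem _ _ h2] at this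
  · -- the lead
    intro j μ hμ Q hQ
    obtain ⟨hμ1, hμ2⟩ := hμ
    -- the walk of `Q`
    obtain ⟨hq, hqcost⟩ := isWalk_of_isWalkI L (rowOf Q) (isWalkI_rowOf hW0 Q)
    rw [rowOf_zero] at hq hqcost
    have hne : (List.ofFn fun i : Fin L.length => rowOf Q (↑i + 1)) ≠ path n m 0 j.val := by
      intro heq
      apply hQ
      rw [← ofWalk_rowOf hW0 hW Q]
      refine ofWalk_congr hW0 hW _ _ _ _ fun i hi => ?_
      cases i with
      | zero => rw [rowOf_zero, hf0]
      | succ i =>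
        have hi' : i < L.length := by omega
        have h1 : (path n m 0 j.val)[i]? = some (rowOf Q (i + 1)) := by
          rw [← heq, List.getElem?_ofFn, dif_pos hi']
        simp only [hfdef, List.getD_eq_getElem?_getD, List.getElem?_cons_succ, h1, Option.getD_some]
    have hmain := main_ineq hn m 1 0 0 j.val μ _ (by simp) Nat.one_pos j.isLt hμ1 (by linarith) hq hne
    rw [cost_ofWalk, ← (hf j.val j.isLt).2]
    rw [← ofWalk_rowOf hW0 hW Q, cost_ofWalk, ← hqcost]
    exact hmain

/-- **At least `n^m − 1` breakpoints** (Mulmuley–Shah Thm 3.1; GR19 Thm 1: `n^m` pieces): for `n ≥ 2` and all `m`,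
a parametric DAG on `k + 1 ≤ 3^m (1 + mn) + 1` vertices whose shortest-path cost has `n^m − 1` breakpoints,
listed increasingly. [cite: GajjarRadhakrishnan2019, Thm 1] -/
theorem exists_strictMono_isBreakpoint (n m : ℕ) (hn : 2 ≤ n) :
    ∃ (k : ℕ) (G : ParamDAG k) (N : ℕ) (β : Fin N → ℝ),
      k + 1 ≤ 3 ^ m * (1 + m * n) + 1 ∧ n ^ m = N + 1 ∧ StrictMono β ∧ ∀ i, G.IsBreakpoint (β i) := by
  obtain ⟨k, G, P, u, hk, hP, hlead, -⟩ := exists_paramDAG_leads n m hn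
  obtain ⟨N, hN⟩ : ∃ N, n ^ m = N + 1 := Nat.exists_eq_succ_of_ne_zero (pow_ne_zero m (by omega))
  have hL : (0 : ℝ) < (n : ℝ) ^ 2 - 2 := by
    have : (2 : ℝ) ≤ n := by exact_mod_cast hn
    nlinarith
  obtain ⟨β, hβ, hbp⟩ := exists_strictMono_isBreakpoint_of_leads (G := G)
    (fun i => P (Fin.cast hN.symm i)) (fun i i' h => Fin.cast_injective _ (hP h))
    (fun i => u (Fin.cast hN.symm i)) hL
    (fun i μ hμ Q hQ => by linarith [hlead (Fin.cast hN.symm i) μ hμ Q hQ])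
  exact ⟨k, G, N, β, hk, hN, hβ, hbp⟩

/-- **Super-polynomially many breakpoints, natural slopes.**  For all `C, c` there is a parametric DAG on `k + 1`
vertices all of whose edge slopes are natural numbers, with more than `C·(k + 1)^c` breakpoints (listed
increasingly) — the form in which the bound feeds lacunary polynomials `Σ_paths (∏ c_e)·t^{Σ b_e}`.
[cite: GajjarRadhakrishnan2019, Thm 1] -/
theorem exists_superpolynomial_isBreakpoint_natSlope (C c : ℕ) :
    ∃ (k : ℕ) (G : ParamDAG k) (N : ℕ) (β : Fin N → ℝ),
      (∀ u v, ∃ b : ℕ, G.wb u v = b) ∧ C * (k + 1) ^ c < N ∧ StrictMono β ∧ ∀ i, G.IsBreakpoint (β i) := by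
  classical
  set m : ℕ := c + 1 with hm
  set X : ℕ := 3 ^ (m + 1) * (m + 1) with hX
  set n : ℕ := C * X ^ c + 2 with hn2
  have hn : 2 ≤ n := by rw [hn2]; omega
  obtain ⟨k, G, P, u, hk, hP, hlead, hrat⟩ := exists_paramDAG_leads n m hn
  obtain ⟨N, hN⟩ : ∃ N, n ^ m = N + 1 := Nat.exists_eq_succ_of_ne_zero (pow_ne_zero m (by omega))
  have hL : (0 : ℝ) < (n : ℝ) ^ 2 - 2 := by
    have : (2 : ℝ) ≤ n := by exact_mod_cast hn
    nlinarith
  obtain ⟨β, hβ, hbp⟩ := exists_strictMono_isBreakpoint_of_leads (G := G)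
    (fun i => P (Fin.cast hN.symm i)) (fun i i' h => Fin.cast_injective _ (hP h))
    (fun i => u (Fin.cast hN.symm i)) hL
    (fun i μ hμ Q hQ => by linarith [hlead (Fin.cast hN.symm i) μ hμ Q hQ])
  obtain ⟨wbn, Δ, hΔ, hiff⟩ := exists_natSlope G hrat
  refine ⟨k, G.withWeights G.wa (fun u v => (wbn u v : ℝ)), N, fun i => β i / Δ, fun u v => ⟨wbn u v, rfl⟩, ?_,
    fun i i' h => div_lt_div_of_pos_right (hβ h) hΔ, fun i => (hiff _).1 (hbp i)⟩
  -- the count: `C (k+1)^c ≤ C X^c n^c < n · n^c = n^m = N + 1`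
  have hV : k + 1 ≤ X * n := by
    have h1 : 1 + m * n ≤ (m + 1) * n := by nlinarith
    set A : ℕ := 3 ^ m * (1 + m * n) with hA
    have h4 : 1 ≤ A := Nat.one_le_iff_ne_zero.2 (Nat.mul_ne_zero (pow_ne_zero _ (by norm_num)) (by omega))
    calc k + 1 ≤ A + 1 := hk
      _ ≤ 3 * A := by omega
      _ = 3 ^ (m + 1) * (1 + m * n) := by rw [hA, pow_succ]; ring
      _ ≤ 3 ^ (m + 1) * ((m + 1) * n) := Nat.mul_le_mul_left _ h1
      _ = X * n := by rw [hX]; ring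
  have hpow : C * (k + 1) ^ c ≤ C * X ^ c * n ^ c := by
    calc C * (k + 1) ^ c ≤ C * (X * n) ^ c := Nat.mul_le_mul_left _ (Nat.pow_le_pow_left hV c)
      _ = C * X ^ c * n ^ c := by rw [mul_pow, mul_assoc]
  have hlt : C * X ^ c * n ^ c + 2 ≤ n ^ m := by
    have h1 : n ^ m = n * n ^ c := by rw [hm, pow_succ, mul_comm]
    have h2 : 1 ≤ n ^ c := Nat.one_le_pow _ _ (by omega)
    have h3 : C * X ^ c + 2 ≤ n := by rw [hn2]
    calc C * X ^ c * n ^ c + 2 ≤ C * X ^ c * n ^ c + 2 * n ^ c := by nlinarith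
      _ = (C * X ^ c + 2) * n ^ c := by ring
      _ ≤ n * n ^ c := Nat.mul_le_mul_right _ h3
      _ = n ^ m := h1.symm
  omega


/-- **Super-polynomially many breakpoints.**  For all `C, c` there is a parametric DAG on `k + 1` vertices with
more than `C·(k + 1)^c` breakpoints (take `m = c + 1` and `n = C·X^c + 2`, `X = 3^{m+1}(m+1)`: the graph has at
most `X·n` vertices and `n^{c+1} − 1` breakpoints) — the form "`n^{Ω(log n)}` against `poly(n)`" in which the bound
is used. [cite: GajjarRadhakrishnan2019, Thm 1 (`n^{Ω(log n)}` pieces on `n` vertices)] -/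
theorem exists_superpolynomial_isBreakpoint (C c : ℕ) :
    ∃ (k : ℕ) (G : ParamDAG k) (N : ℕ) (β : Fin N → ℝ),
      C * (k + 1) ^ c < N ∧ StrictMono β ∧ ∀ i, G.IsBreakpoint (β i) := by
  obtain ⟨k, G, N, β, -, hN, hβ, hbp⟩ := exists_superpolynomial_isBreakpoint_natSlope C c
  exact ⟨k, G, N, β, hN, hβ, hbp⟩

end LowerBound

/-! ## Part VI. Paths and the tree's ABP path sums

The tree's `Literature.Computability.AlgebraicComplexity.pathSum w b` (PermanentUniversality.lean) is the weighted
path count from `0` to `b` in the TRANSITIVE DAG on `ℕ` — every pair `a < c` is an arc of weight `w a c` — and is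
what the permanent / Hessenberg-determinant identities of the tree speak about.  Reading the labels of a
`ParamDAG` as such weights (zero off its arcs), the path sum to `b` is the sum over the explicit paths
`P : G.PathTo b` of the products of the labels along `P` (`pathSum_labelsNat`): the bridge by which a consumer
turns "`N` breakpoints of the envelope of the path lines" into a statement about one lacunary polynomial
`Σ_P (∏_e c_e)·t^{Σ_e b_e}` computed by a branching program. -/

section PathSums

open Literature.Computability.AlgebraicComplexity (pathSum pathSum_zero pathSum_succ)

variable {k : ℕ} {G : ParamDAG k} {R : Type*} [CommSemiring R]

/-- Appending a value to a finite sequence (a non-dependent `Fin.snoc`). [folklore] -/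
def snocFn {n : ℕ} {α : Type*} (f : Fin (n + 1) → α) (x : α) (i : Fin (n + 1 + 1)) : α :=
  if h : i.val < n + 1 then f ⟨i.val, h⟩ else x

/-- `snocFn` below the new index. [folklore] -/
theorem snocFn_of_lt {n : ℕ} {α : Type*} (f : Fin (n + 1) → α) (x : α) (i : Fin (n + 1 + 1))
    (h : i.val < n + 1) : snocFn f x i = f ⟨i.val, h⟩ := by
  simp [snocFn, h]

/-- `snocFn` at the new index. [folklore] -/
theorem snocFn_of_not_lt {n : ℕ} {α : Type*} (f : Fin (n + 1) → α) (x : α) (i : Fin (n + 1 + 1))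
    (h : ¬ i.val < n + 1) : snocFn f x i = x := by
  simp [snocFn, h]

namespace PathTo

variable {a c : Fin (k + 1)}

/-- The product of the labels `ℓ` along a path (its weight in a branching program). [folklore] -/
def prodLabels (ℓ : Fin (k + 1) → Fin (k + 1) → R) (P : G.PathTo a) : R :=
  ∏ d : Fin P.len, ℓ (P.verts d.castSucc) (P.verts d.succ)

/-- A path extended by one arc. [folklore] -/
def snoc (P : G.PathTo a) (h : G.adj a c) : G.PathTo c where
  len := P.len + 1
  verts := snocFn P.verts c
  start := by
    show snocFn P.verts c 0 = 0
    rw [snocFn_of_lt _ _ _ (by simp)]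
    exact P.start
  stop := snocFn_of_not_lt _ _ _ (by simp)
  step d := by
    show G.adj (snocFn P.verts c d.castSucc) (snocFn P.verts c d.succ)
    have hd1 : (d.castSucc).val < P.len + 1 := by rw [Fin.val_castSucc]; exact d.isLt
    rw [snocFn_of_lt _ _ _ hd1]
    by_cases hd : d.val < P.len
    · have hd2 : (d.succ).val < P.len + 1 := by simpa using hd
      rw [snocFn_of_lt _ _ _ hd2]
      exact P.step ⟨d.val, hd⟩
    · have hd' : d.val = P.len := by omega
      have hd2 : ¬ (d.succ).val < P.len + 1 := by simp [hd']
      rw [snocFn_of_not_lt _ _ _ hd2]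
      have e1 : (⟨(d.castSucc).val, hd1⟩ : Fin (P.len + 1)) = Fin.last P.len := Fin.ext (by simp [hd'])
      rw [e1, P.stop]
      exact h

/-- The weight of an extended path. [folklore] -/
theorem prodLabels_snoc (ℓ : Fin (k + 1) → Fin (k + 1) → R) (P : G.PathTo a) (h : G.adj a c) :
    (P.snoc h).prodLabels ℓ = P.prodLabels ℓ * ℓ a c := by
  unfold prodLabels
  show ∏ d : Fin (P.len + 1), ℓ (snocFn P.verts c d.castSucc) (snocFn P.verts c d.succ) = _
  rw [Fin.prod_univ_castSucc]
  congr 1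
  · refine Finset.prod_congr rfl fun d _ => ?_
    rw [snocFn_of_lt _ _ _ (by simp), snocFn_of_lt _ _ _ (by simp)]
    rfl
  · rw [snocFn_of_lt _ _ _ (by simp), snocFn_of_not_lt _ _ _ (by simp)]
    have e1 : (⟨((Fin.last P.len).castSucc).val, by simp⟩ : Fin (P.len + 1)) = Fin.last P.len := Fin.ext (by simp)
    rw [e1, P.stop]

/-- The penultimate vertex of a path (the source, for the trivial path). [folklore] -/
def pen (Q : G.PathTo c) : Fin (k + 1) := Q.verts ⟨Q.len - 1, by omega⟩

/-- A path without its last arc (itself, for the trivial path). [folklore] -/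
def init (Q : G.PathTo c) : G.PathTo Q.pen where
  len := Q.len - 1
  verts i := Q.verts ⟨i.val, by omega⟩
  start := Q.start
  stop := rfl
  step d := Q.step ⟨d.val, by omega⟩

/-- A path to a vertex other than the source has an arc. [folklore] -/
theorem len_pos_of_ne (Q : G.PathTo c) (hc : c ≠ 0) : 0 < Q.len := by
  by_contra h
  have h0 : Q.len = 0 := by omega
  apply hc
  rw [← Q.stop, ← Q.start]
  congr 1
  exact Fin.ext (by simp [h0])

/-- The last arc of a nontrivial path. [folklore] -/
theorem adj_pen (Q : G.PathTo c) (h : 0 < Q.len) : G.adj Q.pen c := by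
  have hstep := Q.step ⟨Q.len - 1, by omega⟩
  have e2 : (Fin.succ ⟨Q.len - 1, by omega⟩ : Fin (Q.len + 1)) = Fin.last Q.len := Fin.ext (by simp; omega)
  rw [e2, Q.stop] at hstep
  exact hstep

/-- A nontrivial path is its `init` extended by its last arc. [folklore] -/
theorem snoc_init (Q : G.PathTo c) (h : 0 < Q.len) : Q.init.snoc (Q.adj_pen h) = Q := by
  refine PathTo.ext' (by show Q.len - 1 + 1 = Q.len; omega) fun i => ?_
  show snocFn Q.init.verts c i = _
  by_cases hi : i.val < Q.len - 1 + 1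
  · rw [snocFn_of_lt _ _ _ hi]
    rfl
  · rw [snocFn_of_not_lt _ _ _ hi]
    have hil : i.val < Q.len - 1 + 1 + 1 := i.isLt
    have e1 : (Fin.cast (by show Q.len - 1 + 1 + 1 = Q.len + 1; omega) i : Fin (Q.len + 1)) = Fin.last Q.len :=
      Fin.ext (by simp; omega)
    rw [e1, Q.stop]

/-- Paths to equal vertices with the same length and vertices are `HEq`. [folklore] -/
theorem heq_of_verts_eq {a a' : Fin (k + 1)} (h : a = a') {P : G.PathTo a} {P' : G.PathTo a'}
    (hl : P.len = P'.len) (hv : ∀ i : Fin (P.len + 1), P.verts i = P'.verts (Fin.cast (by rw [hl]) i)) :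
    HEq P P' := by
  subst h
  exact heq_of_eq (PathTo.ext' hl hv)

/-- The penultimate vertex of an extended path. [folklore] -/
theorem pen_snoc (P : G.PathTo a) (h : G.adj a c) : (P.snoc h).pen = a := by
  show snocFn P.verts c ⟨P.len + 1 - 1, _⟩ = a
  rw [snocFn_of_lt _ _ _ (by show P.len + 1 - 1 < P.len + 1; omega)]
  have e1 : (⟨(⟨P.len + 1 - 1, by omega⟩ : Fin (P.len + 1 + 1)).val, by show P.len + 1 - 1 < P.len + 1; omega⟩ :
      Fin (P.len + 1)) = Fin.last P.len := Fin.ext (by simp)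
  rw [e1, P.stop]

/-- `init` undoes `snoc`. [folklore] -/
theorem init_snoc (P : G.PathTo a) (h : G.adj a c) : HEq (P.snoc h).init P := by
  refine heq_of_verts_eq (pen_snoc P h) (by show P.len + 1 - 1 = P.len; omega) fun i => ?_
  have hi : i.val < P.len + 1 := by
    have := i.isLt
    have hl : (P.snoc h).init.len = P.len + 1 - 1 := rfl
    omega
  show snocFn P.verts c ⟨i.val, _⟩ = _
  rw [snocFn_of_lt _ _ _ hi]
  rfl

end PathTo

/-- All paths from the source, with their endpoint. [folklore] -/
abbrev APath (G : ParamDAG k) := Σ b : Fin (k + 1), G.PathTo b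

/-- Paths to `c ≠ 0` correspond to (path to some `a`, arc `a → c`). [folklore] -/
def snocEquiv (G : ParamDAG k) (c : Fin (k + 1)) (hc : c ≠ 0) : G.PathTo c ≃ {x : G.APath // G.adj x.1 c} where
  toFun Q := ⟨⟨Q.pen, Q.init⟩, Q.adj_pen (Q.len_pos_of_ne hc)⟩
  invFun x := x.1.2.snoc x.2
  left_inv Q := PathTo.snoc_init Q (Q.len_pos_of_ne hc)
  right_inv := by
    rintro ⟨⟨a, P⟩, h⟩
    apply Subtype.ext
    show (⟨(P.snoc h).pen, (P.snoc h).init⟩ : G.APath) = ⟨a, P⟩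
    exact Sigma.ext (PathTo.pen_snoc P h) (PathTo.init_snoc P h)

open Classical in
/-- Decomposing the sum over the paths to `c ≠ 0` along the last arc. [folklore] -/
theorem sum_prodLabels_eq (ℓ : Fin (k + 1) → Fin (k + 1) → R) (c : Fin (k + 1)) (hc : c ≠ 0) :
    ∑ Q : G.PathTo c, Q.prodLabels ℓ =
      ∑ a : Fin (k + 1), (∑ P : G.PathTo a, P.prodLabels ℓ) * (if G.adj a c then ℓ a c else 0) := by
  calc ∑ Q : G.PathTo c, Q.prodLabels ℓ
      = ∑ x : {x : G.APath // G.adj x.1 c}, (x.1.2.snoc x.2).prodLabels ℓ := by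
        refine Fintype.sum_equiv (G.snocEquiv c hc) _ _ fun Q => ?_
        simp only [snocEquiv, Equiv.coe_fn_mk]
        rw [PathTo.snoc_init Q (Q.len_pos_of_ne hc)]
    _ = ∑ x : {x : G.APath // G.adj x.1 c}, x.1.2.prodLabels ℓ * ℓ x.1.1 c :=
        Finset.sum_congr rfl fun x _ => PathTo.prodLabels_snoc ℓ _ _
    _ = ∑ x ∈ (Finset.univ : Finset G.APath).filter (fun x => G.adj x.1 c), x.2.prodLabels ℓ * ℓ x.1 c :=
        (Finset.sum_subtype _ (fun x => by simp) (fun x : G.APath => x.2.prodLabels ℓ * ℓ x.1 c)).symm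
    _ = ∑ x : G.APath, if G.adj x.1 c then x.2.prodLabels ℓ * ℓ x.1 c else 0 := Finset.sum_filter _ _
    _ = ∑ a : Fin (k + 1), ∑ P : G.PathTo a, if G.adj a c then P.prodLabels ℓ * ℓ a c else 0 :=
        Fintype.sum_sigma (fun x : G.APath => if G.adj x.1 c then x.2.prodLabels ℓ * ℓ x.1 c else 0)
    _ = ∑ a : Fin (k + 1), (∑ P : G.PathTo a, P.prodLabels ℓ) * (if G.adj a c then ℓ a c else 0) := by
        refine Finset.sum_congr rfl fun a _ => ?_
        rw [Finset.sum_mul]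
        refine Finset.sum_congr rfl fun P _ => ?_
        split_ifs <;> simp

open Classical in
/-- The labels `ℓ` of the arcs of `G` as weights of the transitive DAG on `ℕ` (zero off the arcs and outside the
vertex range) — the input format of `Literature.Computability.AlgebraicComplexity.pathSum`. [folklore] -/
def labelsNat (G : ParamDAG k) (ℓ : Fin (k + 1) → Fin (k + 1) → R) (a c : ℕ) : R :=
  if h : a < k + 1 ∧ c < k + 1 then (if G.adj ⟨a, h.1⟩ ⟨c, h.2⟩ then ℓ ⟨a, h.1⟩ ⟨c, h.2⟩ else 0) else 0

open Classical in
/-- **Path sums are sums over paths.**  With the labels of `G` as weights (zero off its arcs), the tree's weighted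
path count `pathSum` from `0` to `b` is the sum over the explicit paths `P : G.PathTo b` of the products of the
labels along `P`. [folklore] -/
theorem pathSum_labelsNat (G : ParamDAG k) (ℓ : Fin (k + 1) → Fin (k + 1) → R) :
    ∀ (b : ℕ) (hb : b < k + 1), pathSum (G.labelsNat ℓ) b = ∑ P : G.PathTo ⟨b, hb⟩, P.prodLabels ℓ := by
  intro b
  induction b using Nat.strong_induction_on with
  | _ b ih =>
    intro hb
    cases b with
    | zero =>
      rw [pathSum_zero]
      -- the trivial path is the only path to the source
      let nil : G.PathTo ⟨0, hb⟩ := ⟨0, fun _ => 0, rfl, Fin.ext (by simp), fun d => d.elim0⟩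
      have hall : ∀ P : G.PathTo ⟨0, hb⟩, P = nil := by
        intro P
        have hlen : P.len = 0 := by
          by_contra hne
          have hlt := P.strictMono (show (0 : Fin (P.len + 1)) < Fin.last P.len from
            Fin.lt_def.2 (by simp; omega))
          rw [P.start, P.stop] at hlt
          exact absurd (Fin.lt_def.1 hlt) (by simp)
        refine PathTo.ext' hlen fun i => ?_
        have hi : i = 0 := Fin.ext (by have := i.isLt; simp; omega)
        rw [hi, P.start]
      rw [Fintype.sum_eq_single nil (fun P hP => absurd (hall P) hP)]
      exact (Fin.prod_univ_zero _).symm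
    | succ b =>
      have hc0 : (⟨b + 1, hb⟩ : Fin (k + 1)) ≠ 0 := by
        intro h
        have := congrArg Fin.val h
        simp at this
      rw [pathSum_succ, sum_prodLabels_eq ℓ ⟨b + 1, hb⟩ hc0]
      -- extend the range: labels into `b + 1` vanish from `a ≥ b + 1`
      have hvan : ∀ a, b + 1 ≤ a → a < k + 1 → G.labelsNat ℓ a (b + 1) = 0 := by
        intro a ha hak
        rw [labelsNat, dif_pos ⟨hak, hb⟩, if_neg]
        intro hadj
        have := Fin.lt_def.1 (G.adj_lt _ _ hadj)
        simp at this
        omega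
      rw [Finset.sum_subset (Finset.range_mono (show b + 1 ≤ k + 1 by omega)) (fun a ha hna => by
        rw [Finset.mem_range] at ha hna
        rw [hvan a (by omega) ha, mul_zero]), ← Fin.sum_univ_eq_sum_range]
      refine Finset.sum_congr rfl fun a _ => ?_
      have hlab : G.labelsNat ℓ a.val (b + 1) = if G.adj a ⟨b + 1, hb⟩ then ℓ a ⟨b + 1, hb⟩ else 0 := by
        rw [labelsNat, dif_pos ⟨a.isLt, hb⟩]
      rw [hlab]
      by_cases hadj : G.adj a ⟨b + 1, hb⟩
      · have ha : a.val < b + 1 := by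
          have := Fin.lt_def.1 (G.adj_lt _ _ hadj)
          simpa using this
        rw [ih a.val ha a.isLt]
      · rw [if_neg hadj, mul_zero, mul_zero]

/-- **The `s`–`t` path sum.**  In particular the path sum from the source to the sink is the sum over the `s`–`t`
paths. [folklore] -/
theorem pathSum_labelsNat_eq_sum_paths (G : ParamDAG k) (ℓ : Fin (k + 1) → Fin (k + 1) → R) :
    pathSum (G.labelsNat ℓ) k = ∑ P : G.Path, P.prodLabels ℓ :=
  pathSum_labelsNat G ℓ k (Nat.lt_succ_self k)

end PathSums

end ParamDAG

end Literature.Combinatorics.Optimization
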